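import Summits.Ventures.Crystal3D.Theorems.StickyWulffConstantGenericWallFloorCredits
import Literature.Algebra.EuclideanLattices.FccBccLattices
import HarnessLib

/-!
# A ball resting in a hollow of a complete layer patch, part 1: the planar covering algebra, the half-space lemma and the boundary
# identification in model coordinates (crux `GenericWallFloor`, stmt-Ventures-19480, line `WallLedgerG`; memo HONEST-LAMBDA-g12 §4(a))

HONEST FRAMING. Venture `Summits/Ventures/Crystal3D` (cell `crystal3d-full`), helper `--supports` the crux `GenericWallFloor`
(stmt-Ventures-19480) of `route-Ventures-StickyWulffConstant`, REGISTERED line `WallLedgerG`, open stub `stub_twoSlabAdhesion`.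
Rung credit only; F-C1 not moved; NOT the stub; census-free, standard axioms, nothing conditional in this part.

SETTING (model coordinates of the tree's Barlow stackings: close-packed layers horizontal, in-layer spacing `1`, layer height `√(2/3)`).
A ball at the origin RESTS IN A HOLLOW of the layer below when the six patch points
`d₁ = (−½, −√3/6, −√(2/3))`, `d₂ = (½, −√3/6, −√(2/3))`, `d₃ = (0, √3/3, −√(2/3))` (its three supports, at distance `1`) and
`d₄ = (1, √3/3, −√(2/3))`, `d₅ = (−1, √3/3, −√(2/3))`, `d₆ = (0, −2√3/3, −√(2/3))` (the three across-edge points, at distance `√2`) —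
the side-`2` triangle of the layer below with its edge midpoints — are balls.  Its IN-PLANE HOLLOW RING is the six vectors `±(1,0,0)`,
`±(½, √3/2, 0)`, `±(½, −√3/2, 0)`.

* `hollow_cover_core` / `hollow_cover_three`, `hollow_ident_core` / `hollow_ident_three` — the planar algebra: the six discs of radius
  `1/√3` about the planar parts of the patch points cover the closed unit disc, and touch the unit circle exactly at the six ring
  directions (in the three components `aₖ = ⟪x′, Pₖ⟫`, `Σ aₖ = 0`, `Σ aₖ² = |x′|²/2`).
* **`coord_two_nonneg_of_hollowPatch`** — a unit vector at distance `≥ 1` from the six `dₖ` has non-negative height: every contact of a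
  hollow ball other than its three supports lies in the CLOSED UPPER HALF-SPACE through its centre.
* **`mem_hollowRing_of_boundary`** — such a vector of height exactly `0` is one of the six ring vectors.
The sequel `…GenericWallFloorHollowRing` combines these with Kertész\'s nine-point theorem.
WHAT THIS IS NOT: no statement about configurations `X` yet (sequel); F-C1 not moved.
-/

noncomputable section

namespace Summit.Ventures.Crystal3D.Theorems

open Finset
open scoped InnerProductSpace

/-! ### Planar algebra: the six discs of radius `1/√3` cover the unit disc -/

/-- Squared distance to a literal vector, in coordinates. -/
theorem norm_sub_vec3_sq (x : EuclideanSpace ℝ (Fin 3)) (a b c : ℝ) :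
    ‖x - !₂[a, b, c]‖ ^ 2 = (x 0 - a) ^ 2 + (x 1 - b) ^ 2 + (x 2 - c) ^ 2 := by
  rw [Literature.Algebra.EuclideanLattices.norm_sq_fin_three]; simp

/-- The final inequality of the covering argument (minimal context for `nlinarith`). -/
theorem hollow_cover_final {M m R : ℝ} (hE : M ^ 2 + m ^ 2 + M * m = R / 4) (ha : 0 ≤ 2 * M + m) (hb : M + 2 * m ≤ 0)
    (hR0 : 0 ≤ R) (hR1 : R ≤ 1) (hin : 2 * M < R) (hM0 : 0 ≤ M) (hMsq : R ≤ 12 * M ^ 2) : R + 1 + 4 * m ≤ 0 := by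
  nlinarith [mul_nonneg (sub_nonneg.2 hMsq) (sub_nonneg.2 hin.le), mul_nonneg (sub_nonneg.2 hin.le) (sub_nonneg.2 hR1),
    mul_nonneg (sub_nonneg.2 hMsq) (sub_nonneg.2 hR1), sq_nonneg (R + 1 + 4 * m), sq_nonneg (2 * M - R),
    mul_nonneg hM0 (sub_nonneg.2 hin.le)]

/-- The largest of three planar components is at least `60°`-close: `R ≤ 12 M²`. -/
theorem hollow_cover_sq {M m R : ℝ} (hE : M ^ 2 + m ^ 2 + M * m = R / 4) (ha : 0 ≤ 2 * M + m) (hb : M + 2 * m ≤ 0) :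
    R ≤ 12 * M ^ 2 := by
  have h3 : (2 * M + m) * (M + 2 * m) ≤ 0 := mul_nonpos_iff.2 (Or.inl ⟨ha, hb⟩)
  nlinarith [h3]

/-- **Covering core** (ordered components `M ≥ μ ≥ m`, `M + μ + m = 0`, `M² + μ² + m² = R/2`, `R ≤ 1`): the inner disc of the largest
component or the outer disc of the smallest one contains the point — `2M ≥ R` or `R + 1 + 4m ≤ 0`. -/
theorem hollow_cover_core {M μ m R : ℝ} (h1 : μ ≤ M) (h2 : m ≤ μ) (hs : M + μ + m = 0) (hq : M ^ 2 + μ ^ 2 + m ^ 2 = R / 2)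
    (hR1 : R ≤ 1) (hin : 2 * M < R) (hout : 0 < R + 1 + 4 * m) : False := by
  have hμ : μ = -M - m := by linarith
  subst hμ
  have hE : M ^ 2 + m ^ 2 + M * m = R / 4 := by linear_combination (1 / 2 : ℝ) * hq
  have ha : 0 ≤ 2 * M + m := by linarith
  have hb : M + 2 * m ≤ 0 := by linarith
  have hM0 : 0 ≤ M := by linarith
  have := hollow_cover_final hE ha hb (by nlinarith) hR1 hin hM0 (hollow_cover_sq hE ha hb)
  linarith

/-- The identification step, largest component (minimal context). -/
theorem hollow_ident_M {M m : ℝ} (hE : M ^ 2 + m ^ 2 + M * m = 1 / 4) (ha : 0 ≤ 2 * M + m)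
    (hM : M ≤ 1 / 2) (hm : -(1 / 2) ≤ m) (hm0 : m ≤ 0) : M = 1 / 2 := by
  nlinarith [mul_nonneg (sub_nonneg.2 hM) (sub_nonneg.2 hm), mul_nonneg (neg_nonneg.2 hm0) (sub_nonneg.2 hm)]

/-- **Identification core** (ordered components on the unit circle, all six discs closed-avoided): the components are `½, 0, −½`. -/
theorem hollow_ident_core {M μ m : ℝ} (h1 : μ ≤ M) (h2 : m ≤ μ) (hs : M + μ + m = 0) (hq : M ^ 2 + μ ^ 2 + m ^ 2 = 1 / 2)
    (hM : M ≤ 1 / 2) (hm : -(1 / 2) ≤ m) : M = 1 / 2 ∧ μ = 0 ∧ m = -(1 / 2) := by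
  have hμ : μ = -M - m := by linarith
  subst hμ
  have hE : M ^ 2 + m ^ 2 + M * m = 1 / 4 := by linear_combination (1 / 2 : ℝ) * hq
  have ha : 0 ≤ 2 * M + m := by linarith
  have hb : M + 2 * m ≤ 0 := by linarith
  have hM0 : 0 ≤ M := by linarith
  have hm0 : m ≤ 0 := by linarith
  have hMe : M = 1 / 2 := hollow_ident_M hE ha hM hm hm0
  subst hMe
  have hme : m = -(1 / 2) := by
    nlinarith [mul_nonneg (neg_nonneg.2 hm0) (sub_nonneg.2 hm)]
  subst hme
  exact ⟨rfl, by ring, rfl⟩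

/-- **Covering, unordered form**: three reals with sum `0` and sum of squares `R/2 ≤ ½` cannot all have `2aₖ < R` and `R + 1 + 4aₖ > 0`. -/
theorem hollow_cover_three {a₁ a₂ a₃ R : ℝ} (hs : a₁ + a₂ + a₃ = 0) (hq : a₁ ^ 2 + a₂ ^ 2 + a₃ ^ 2 = R / 2) (hR1 : R ≤ 1)
    (hi₁ : 2 * a₁ < R) (hi₂ : 2 * a₂ < R) (hi₃ : 2 * a₃ < R)
    (ho₁ : 0 < R + 1 + 4 * a₁) (ho₂ : 0 < R + 1 + 4 * a₂) (ho₃ : 0 < R + 1 + 4 * a₃) : False := by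
  rcases le_total a₂ a₁ with h12 | h12 <;> rcases le_total a₃ a₂ with h23 | h23 <;> rcases le_total a₃ a₁ with h13 | h13
  · exact hollow_cover_core h12 h23 hs hq hR1 hi₁ ho₃
  · exact hollow_cover_core h12 h23 hs hq hR1 hi₁ ho₃
  · exact hollow_cover_core h13 h23 (by linarith) (by linear_combination hq) hR1 hi₁ ho₂
  · exact hollow_cover_core h13 h12 (by linarith) (by linear_combination hq) hR1 hi₃ ho₂
  · exact hollow_cover_core h12 h13 (by linarith) (by linear_combination hq) hR1 hi₂ ho₃
  · exact hollow_cover_core h23 h13 (by linarith) (by linear_combination hq) hR1 hi₂ ho₁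
  · exact hollow_cover_core h23 h12 (by linarith) (by linear_combination hq) hR1 hi₃ ho₁
  · exact hollow_cover_core h23 h12 (by linarith) (by linear_combination hq) hR1 hi₃ ho₁

/-- **Identification, unordered form**: three reals with sum `0`, sum of squares `½`, all in `[−½, ½]` are `½, 0, −½` in some order. -/
theorem hollow_ident_three {a₁ a₂ a₃ : ℝ} (hs : a₁ + a₂ + a₃ = 0) (hq : a₁ ^ 2 + a₂ ^ 2 + a₃ ^ 2 = 1 / 2)
    (hu₁ : a₁ ≤ 1 / 2) (hu₂ : a₂ ≤ 1 / 2) (hu₃ : a₃ ≤ 1 / 2)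
    (hl₁ : -(1 / 2) ≤ a₁) (hl₂ : -(1 / 2) ≤ a₂) (hl₃ : -(1 / 2) ≤ a₃) :
    (a₁ = 1 / 2 ∧ a₂ = 0 ∧ a₃ = -(1 / 2)) ∨ (a₁ = 1 / 2 ∧ a₃ = 0 ∧ a₂ = -(1 / 2)) ∨
      (a₂ = 1 / 2 ∧ a₁ = 0 ∧ a₃ = -(1 / 2)) ∨ (a₂ = 1 / 2 ∧ a₃ = 0 ∧ a₁ = -(1 / 2)) ∨
      (a₃ = 1 / 2 ∧ a₁ = 0 ∧ a₂ = -(1 / 2)) ∨ (a₃ = 1 / 2 ∧ a₂ = 0 ∧ a₁ = -(1 / 2)) := by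
  rcases le_total a₂ a₁ with h12 | h12 <;> rcases le_total a₃ a₂ with h23 | h23 <;> rcases le_total a₃ a₁ with h13 | h13
  · exact Or.inl (hollow_ident_core h12 h23 hs hq hu₁ hl₃)
  · exact Or.inl (hollow_ident_core h12 h23 hs hq hu₁ hl₃)
  · exact Or.inr (Or.inl (hollow_ident_core h13 h23 (by linarith) (by linear_combination hq) hu₁ hl₂))
  · exact Or.inr (Or.inr (Or.inr (Or.inr (Or.inl (hollow_ident_core h13 h12 (by linarith) (by linear_combination hq) hu₃ hl₂)))))
  · exact Or.inr (Or.inr (Or.inl (hollow_ident_core h12 h13 (by linarith) (by linear_combination hq) hu₂ hl₃)))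
  · exact Or.inr (Or.inr (Or.inr (Or.inl (hollow_ident_core h23 h13 (by linarith) (by linear_combination hq) hu₂ hl₁))))
  · exact Or.inr (Or.inr (Or.inr (Or.inr (Or.inr (hollow_ident_core h23 h12 (by linarith) (by linear_combination hq) hu₃ hl₁)))))
  · exact Or.inr (Or.inr (Or.inr (Or.inr (Or.inr (hollow_ident_core h23 h12 (by linarith) (by linear_combination hq) hu₃ hl₁)))))

/-! ### The half-space lemma and the boundary identification, in model coordinates -/

/-- Missing an inner disc: `2⟪x', P⟫ < |x'|²` (planar, `|P|² = 1/3`). -/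
theorem hollow_inner_miss {x0 x1 c0 c1 : ℝ} (hc : c0 ^ 2 + c1 ^ 2 = 1 / 3) (h : 1 / 3 < (x0 - c0) ^ 2 + (x1 - c1) ^ 2) :
    2 * (c0 * x0 + c1 * x1) < x0 ^ 2 + x1 ^ 2 := by linear_combination h + hc

/-- Missing an outer disc (centre `−2P`): `0 < |x'|² + 1 + 4⟪x', P⟫`. -/
theorem hollow_outer_miss {x0 x1 c0 c1 o0 o1 : ℝ} (ho0 : o0 = -2 * c0) (ho1 : o1 = -2 * c1) (hc : c0 ^ 2 + c1 ^ 2 = 1 / 3)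
    (h : 1 / 3 < (x0 - o0) ^ 2 + (x1 - o1) ^ 2) : 0 < x0 ^ 2 + x1 ^ 2 + 1 + 4 * (c0 * x0 + c1 * x1) := by
  subst ho0 ho1; linear_combination h + 4 * hc

/-- Closed-avoiding an inner disc on the unit circle: `⟪x', P⟫ ≤ ½`. -/
theorem hollow_inner_touch {x0 x1 c0 c1 : ℝ} (hc : c0 ^ 2 + c1 ^ 2 = 1 / 3) (hn : x0 ^ 2 + x1 ^ 2 = 1)
    (h : 1 / 3 ≤ (x0 - c0) ^ 2 + (x1 - c1) ^ 2) : c0 * x0 + c1 * x1 ≤ 1 / 2 := by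
  linear_combination h / 2 + hc / 2 + hn / 2

/-- Closed-avoiding an outer disc on the unit circle: `−½ ≤ ⟪x', P⟫`. -/
theorem hollow_outer_touch {x0 x1 c0 c1 o0 o1 : ℝ} (ho0 : o0 = -2 * c0) (ho1 : o1 = -2 * c1) (hc : c0 ^ 2 + c1 ^ 2 = 1 / 3)
    (hn : x0 ^ 2 + x1 ^ 2 = 1) (h : 1 / 3 ≤ (x0 - o0) ^ 2 + (x1 - o1) ^ 2) : -(1 / 2) ≤ c0 * x0 + c1 * x1 := by
  subst ho0 ho1; linear_combination h / 4 + hc + hn / 4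

/-- Below the plane the vertical term is short: `(x₂ + t)² < t² = 2/3` for `−1 ≤ x₂ < 0`. -/
theorem hollow_vert_lt {x2 t : ℝ} (ht : t ^ 2 = 2 / 3) (ht0 : 0 < t) (h : x2 < 0) (h1 : -1 ≤ x2) :
    (x2 - -t) ^ 2 < 2 / 3 := by
  have ht2 : 1 / 2 < t := by nlinarith
  nlinarith [mul_pos (neg_pos.2 h) (show 0 < x2 + 2 * t by linarith)]

/-- `√3` and `√(2/3)`: the facts used. -/
theorem sqrt_three_sqrt_twoThirds_facts :
    Real.sqrt 3 ^ 2 = 3 ∧ 0 < Real.sqrt 3 ∧ Real.sqrt (2 / 3) ^ 2 = 2 / 3 ∧ 0 < Real.sqrt (2 / 3) :=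
  ⟨Real.sq_sqrt (by norm_num), Real.sqrt_pos.2 (by norm_num), Real.sq_sqrt (by norm_num), Real.sqrt_pos.2 (by norm_num)⟩

/-- **The half-space lemma.**  A unit vector `x` at distance `≥ 1` from the six patch points `d₁, …, d₆` (the hollow's three supports
and the three across-edge points, all at height `−√(2/3)`) has non-negative height: the six discs of radius `1/√3` about the patch
points cover the unit disc, so a point below the plane of `f` is too close to one of them. -/
theorem coord_two_nonneg_of_hollowPatch (x : EuclideanSpace ℝ (Fin 3)) (hx : ‖x‖ = 1)
    (h₁ : 1 ≤ ‖x - !₂[-(1 / 2), -(Real.sqrt 3 / 6), -Real.sqrt (2 / 3)]‖)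
    (h₂ : 1 ≤ ‖x - !₂[1 / 2, -(Real.sqrt 3 / 6), -Real.sqrt (2 / 3)]‖)
    (h₃ : 1 ≤ ‖x - !₂[0, Real.sqrt 3 / 3, -Real.sqrt (2 / 3)]‖)
    (h₄ : 1 ≤ ‖x - !₂[1, Real.sqrt 3 / 3, -Real.sqrt (2 / 3)]‖)
    (h₅ : 1 ≤ ‖x - !₂[-1, Real.sqrt 3 / 3, -Real.sqrt (2 / 3)]‖)
    (h₆ : 1 ≤ ‖x - !₂[0, -(2 * Real.sqrt 3 / 3), -Real.sqrt (2 / 3)]‖) : 0 ≤ x 2 := by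
  obtain ⟨hs, hs0, ht, ht0⟩ := sqrt_three_sqrt_twoThirds_facts
  have hn : x 0 ^ 2 + x 1 ^ 2 + x 2 ^ 2 = 1 := by rw [← Literature.Algebra.EuclideanLattices.norm_sq_fin_three, hx, one_pow]
  have sq1 : ∀ {v : EuclideanSpace ℝ (Fin 3)}, 1 ≤ ‖x - v‖ → 1 ≤ ‖x - v‖ ^ 2 := fun h => one_le_pow₀ h
  have e₁ := sq1 h₁; have e₂ := sq1 h₂; have e₃ := sq1 h₃; have e₄ := sq1 h₄; have e₅ := sq1 h₅; have e₆ := sq1 h₆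
  rw [norm_sub_vec3_sq] at e₁ e₂ e₃ e₄ e₅ e₆
  by_contra hneg
  push Not at hneg
  -- below the plane the vertical term is `< 2/3`
  have hx2sq : x 2 ^ 2 ≤ 1 := by linarith [sq_nonneg (x 0), sq_nonneg (x 1)]
  have hx2 : -1 ≤ x 2 := (abs_le.1 ((sq_le_one_iff_abs_le_one (x 2)).1 hx2sq)).1
  have hvert : (x 2 - -Real.sqrt (2 / 3)) ^ 2 < 2 / 3 := hollow_vert_lt ht ht0 hneg hx2
  -- the six planar discs are missed
  have p₁ : 1 / 3 < (x 0 - -(1 / 2)) ^ 2 + (x 1 - -(Real.sqrt 3 / 6)) ^ 2 := by linarith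
  have p₂ : 1 / 3 < (x 0 - 1 / 2) ^ 2 + (x 1 - -(Real.sqrt 3 / 6)) ^ 2 := by linarith
  have p₃ : 1 / 3 < (x 0 - 0) ^ 2 + (x 1 - Real.sqrt 3 / 3) ^ 2 := by linarith
  have p₄ : 1 / 3 < (x 0 - 1) ^ 2 + (x 1 - Real.sqrt 3 / 3) ^ 2 := by linarith
  have p₅ : 1 / 3 < (x 0 - -1) ^ 2 + (x 1 - Real.sqrt 3 / 3) ^ 2 := by linarith
  have p₆ : 1 / 3 < (x 0 - 0) ^ 2 + (x 1 - -(2 * Real.sqrt 3 / 3)) ^ 2 := by linarith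
  have hc₁ : (-(1 / 2) : ℝ) ^ 2 + (-(Real.sqrt 3 / 6)) ^ 2 = 1 / 3 := by linear_combination (1 / 36 : ℝ) * hs
  have hc₂ : ((1 / 2) : ℝ) ^ 2 + (-(Real.sqrt 3 / 6)) ^ 2 = 1 / 3 := by linear_combination (1 / 36 : ℝ) * hs
  have hc₃ : (0 : ℝ) ^ 2 + (Real.sqrt 3 / 3) ^ 2 = 1 / 3 := by linear_combination (1 / 9 : ℝ) * hs
  have hi₁ := hollow_inner_miss hc₁ p₁
  have hi₂ := hollow_inner_miss hc₂ p₂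
  have hi₃ := hollow_inner_miss hc₃ p₃
  have ho₁ := hollow_outer_miss (by ring) (by ring) hc₁ p₄
  have ho₂ := hollow_outer_miss (by ring) (by ring) hc₂ p₅
  have ho₃ := hollow_outer_miss (by ring) (by ring) hc₃ p₆
  have hR1 : x 0 ^ 2 + x 1 ^ 2 ≤ 1 := by linarith [sq_nonneg (x 2)]
  refine hollow_cover_three (a₁ := -(1 / 2) * x 0 + -(Real.sqrt 3 / 6) * x 1) (a₂ := 1 / 2 * x 0 + -(Real.sqrt 3 / 6) * x 1)
    (a₃ := 0 * x 0 + Real.sqrt 3 / 3 * x 1) (R := x 0 ^ 2 + x 1 ^ 2) (by ring) ?_ hR1 hi₁ hi₂ hi₃ ho₁ ho₂ ho₃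
  linear_combination (1 / 6 : ℝ) * x 1 ^ 2 * hs

/-- **Boundary identification.**  A unit vector of height `0` at distance `≥ 1` from the six patch points is one of the six RING vectors
`±(1,0,0)`, `±(½, √3/2, 0)`, `±(½, −√3/2, 0)`. -/
theorem mem_hollowRing_of_boundary (x : EuclideanSpace ℝ (Fin 3)) (hx : ‖x‖ = 1) (hz : x 2 = 0)
    (h₁ : 1 ≤ ‖x - !₂[-(1 / 2), -(Real.sqrt 3 / 6), -Real.sqrt (2 / 3)]‖)
    (h₂ : 1 ≤ ‖x - !₂[1 / 2, -(Real.sqrt 3 / 6), -Real.sqrt (2 / 3)]‖)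
    (h₃ : 1 ≤ ‖x - !₂[0, Real.sqrt 3 / 3, -Real.sqrt (2 / 3)]‖)
    (h₄ : 1 ≤ ‖x - !₂[1, Real.sqrt 3 / 3, -Real.sqrt (2 / 3)]‖)
    (h₅ : 1 ≤ ‖x - !₂[-1, Real.sqrt 3 / 3, -Real.sqrt (2 / 3)]‖)
    (h₆ : 1 ≤ ‖x - !₂[0, -(2 * Real.sqrt 3 / 3), -Real.sqrt (2 / 3)]‖) :
    x = !₂[1, 0, 0] ∨ x = !₂[-1, 0, 0] ∨ x = !₂[1 / 2, Real.sqrt 3 / 2, 0] ∨ x = !₂[-(1 / 2), -(Real.sqrt 3 / 2), 0] ∨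
      x = !₂[1 / 2, -(Real.sqrt 3 / 2), 0] ∨ x = !₂[-(1 / 2), Real.sqrt 3 / 2, 0] := by
  obtain ⟨hs, hs0, ht, ht0⟩ := sqrt_three_sqrt_twoThirds_facts
  have hn : x 0 ^ 2 + x 1 ^ 2 = 1 := by
    have := Literature.Algebra.EuclideanLattices.norm_sq_fin_three x; rw [hx, one_pow, hz] at this; linarith
  have sq1 : ∀ {v : EuclideanSpace ℝ (Fin 3)}, 1 ≤ ‖x - v‖ → 1 ≤ ‖x - v‖ ^ 2 := fun h => one_le_pow₀ h
  have e₁ := sq1 h₁; have e₂ := sq1 h₂; have e₃ := sq1 h₃; have e₄ := sq1 h₄; have e₅ := sq1 h₅; have e₆ := sq1 h₆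
  rw [norm_sub_vec3_sq, hz] at e₁ e₂ e₃ e₄ e₅ e₆
  have hvert : ((0 : ℝ) - -Real.sqrt (2 / 3)) ^ 2 = 2 / 3 := by rw [sub_neg_eq_add, zero_add, ht]
  have p₁ : 1 / 3 ≤ (x 0 - -(1 / 2)) ^ 2 + (x 1 - -(Real.sqrt 3 / 6)) ^ 2 := by linarith
  have p₂ : 1 / 3 ≤ (x 0 - 1 / 2) ^ 2 + (x 1 - -(Real.sqrt 3 / 6)) ^ 2 := by linarith
  have p₃ : 1 / 3 ≤ (x 0 - 0) ^ 2 + (x 1 - Real.sqrt 3 / 3) ^ 2 := by linarith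
  have p₄ : 1 / 3 ≤ (x 0 - 1) ^ 2 + (x 1 - Real.sqrt 3 / 3) ^ 2 := by linarith
  have p₅ : 1 / 3 ≤ (x 0 - -1) ^ 2 + (x 1 - Real.sqrt 3 / 3) ^ 2 := by linarith
  have p₆ : 1 / 3 ≤ (x 0 - 0) ^ 2 + (x 1 - -(2 * Real.sqrt 3 / 3)) ^ 2 := by linarith
  have hc₁ : (-(1 / 2) : ℝ) ^ 2 + (-(Real.sqrt 3 / 6)) ^ 2 = 1 / 3 := by linear_combination (1 / 36 : ℝ) * hs
  have hc₂ : ((1 / 2) : ℝ) ^ 2 + (-(Real.sqrt 3 / 6)) ^ 2 = 1 / 3 := by linear_combination (1 / 36 : ℝ) * hs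
  have hc₃ : (0 : ℝ) ^ 2 + (Real.sqrt 3 / 3) ^ 2 = 1 / 3 := by linear_combination (1 / 9 : ℝ) * hs
  have hu₁ := hollow_inner_touch hc₁ hn p₁
  have hu₂ := hollow_inner_touch hc₂ hn p₂
  have hu₃ := hollow_inner_touch hc₃ hn p₃
  have hl₁ := hollow_outer_touch (by ring) (by ring) hc₁ hn p₄
  have hl₂ := hollow_outer_touch (by ring) (by ring) hc₂ hn p₅
  have hl₃ := hollow_outer_touch (by ring) (by ring) hc₃ hn p₆
  set a₁ : ℝ := -(1 / 2) * x 0 + -(Real.sqrt 3 / 6) * x 1 with ha₁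
  set a₂ : ℝ := 1 / 2 * x 0 + -(Real.sqrt 3 / 6) * x 1 with ha₂
  set a₃ : ℝ := 0 * x 0 + Real.sqrt 3 / 3 * x 1 with ha₃
  have hsum : a₁ + a₂ + a₃ = 0 := by rw [ha₁, ha₂, ha₃]; ring
  have hsq : a₁ ^ 2 + a₂ ^ 2 + a₃ ^ 2 = 1 / 2 := by
    rw [ha₁, ha₂, ha₃]; linear_combination (1 / 6 : ℝ) * x 1 ^ 2 * hs + (1 / 2 : ℝ) * hn
  -- `x 0 = a₂ − a₁`, `x 1 = √3 · a₃`
  have hx0 : x 0 = a₂ - a₁ := by rw [ha₁, ha₂]; ring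
  have hx1 : x 1 = Real.sqrt 3 * a₃ := by
    rw [ha₃]; linear_combination (-(1 / 3) : ℝ) * x 1 * hs
  have key := hollow_ident_three hsum hsq hu₁ hu₂ hu₃ hl₁ hl₂ hl₃
  have vec : ∀ p q : ℝ, x 0 = p → x 1 = q → x = !₂[p, q, 0] := by
    intro p q hp hq
    ext i; fin_cases i <;> simp [hp, hq, hz]
  rcases key with ⟨k1, k2, k3⟩ | ⟨k1, k2, k3⟩ | ⟨k1, k2, k3⟩ | ⟨k1, k2, k3⟩ | ⟨k1, k2, k3⟩ | ⟨k1, k2, k3⟩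
  · -- (½, 0, −½): x = (−½, −√3/2)
    refine Or.inr (Or.inr (Or.inr (Or.inl (vec _ _ ?_ ?_)))) <;> [rw [hx0, k1, k2]; rw [hx1, k3]] <;> ring
  · -- (½, ·, −½) with a₃ = 0: x = (−1, 0)
    refine Or.inr (Or.inl (vec _ _ ?_ ?_)) <;> [rw [hx0, k1, k3]; rw [hx1, k2]] <;> ring
  · -- a₂ = ½, a₁ = 0, a₃ = −½: x = (½, −√3/2)
    refine Or.inr (Or.inr (Or.inr (Or.inr (Or.inl (vec _ _ ?_ ?_))))) <;> [rw [hx0, k1, k2]; rw [hx1, k3]] <;> ring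
  · -- a₂ = ½, a₃ = 0, a₁ = −½: x = (1, 0)
    refine Or.inl (vec _ _ ?_ ?_) <;> [rw [hx0, k1, k3]; rw [hx1, k2]] <;> ring
  · -- a₃ = ½, a₁ = 0, a₂ = −½: x = (−½, √3/2)
    refine Or.inr (Or.inr (Or.inr (Or.inr (Or.inr (vec _ _ ?_ ?_))))) <;> [rw [hx0, k2, k3]; rw [hx1, k1]] <;> ring
  · -- a₃ = ½, a₂ = 0, a₁ = −½: x = (½, √3/2)
    refine Or.inr (Or.inr (Or.inl (vec _ _ ?_ ?_))) <;> [rw [hx0, k2, k3]; rw [hx1, k1]] <;> ring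

end Summit.Ventures.Crystal3D.Theorems

end
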